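import Mathlib
import Summits.Ventures.PercRepro2.Defs
import Summits.Ventures.PercRepro2.Independence
import Summits.Ventures.PercRepro2.Graph
import Summits.Ventures.PercRepro2.Events
import Summits.Ventures.PercRepro2.Harris
import Summits.Ventures.PercRepro2.MM0Sector
import Summits.Ventures.PercRepro2.MM0Prune
import Summits.Ventures.PercRepro2.MM0SeriesMap
import Summits.Ventures.PercRepro2.MM0Series
import Summits.Ventures.PercRepro2.MM0Parallel

/-!
# Row 2′MM0: the reduction theorem — (MM0⁻) on every graph follows from (MM0⁻) on the REDUCED
markings (blind cell PercRepro2, night-1 g4; `proofs/NIGHT1-G4.md` §3)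

A marking `(ends, s t b u w v)` is REDUCED (`Reduced`) when every vertex carrying no mark has no
non-loop edge or at least three, and no two distinct non-loop edges are parallel.
**`mm0minus_of_reduced`**: if `mm0minusForm p′ ends′ ≤ 0` for every weight vector `p′` on every
reduced marking (same edge type `E`, same marks), then `mm0minusForm p ends ≤ 0` for every weight
vector on every marking. Proof: strong induction on the number of non-loop edges; two parallel
non-loop edges are merged (`MM0Parallel.mm0minusForm_parallel`, one becomes a loop, the weights
combine to «at least one open»); an unmarked vertex with exactly one non-loop edge is pruned
(`MM0Prune.mm0minusForm_update_loop`); one with exactly two is suppressed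
(`MM0Series.mm0minusForm_series`, the two weights multiply) — the last two after its loops have been
re-pointed to the mark `s` (`moveLoops`, which changes no connection), so that the leaf / series
hypotheses hold literally; the non-loop edge count drops by at least one at every step.

The reduced markings are exactly the MARKED SKELETONS of the census (loops and isolated unmarked
vertices aside): on a forest they are the 6,692 + 655 marked forest skeletons, on which (MM0⁻) is
certified exactly by the pattern-coefficient census of kit j215069 through
`MM0Pinned.mm0minus_of_pinned` — the theorem «(MM0⁻) on every forest» (and, with kit j215500–j215503,
«on every graph whose marked skeleton has ≤ 8 edges»).
-/

namespace Summit.Ventures.PercRepro2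
namespace MM0Reduce

open MM0Sector

/-! ## Moving loops -/

section Loops

variable {V : Type*} {E : Type*} [DecidableEq E] [DecidableEq V]

/-- Re-point every loop at `x` to a loop at `y` (edges that are not loops at `x` are unchanged). -/
def moveLoops (ends : E → Sym2 V) (x y : V) : E → Sym2 V :=
  fun e => if ends e = s(x, x) then s(y, y) else ends e

omit [DecidableEq E] in
/-- `moveLoops` changes nothing on edges that are not loops at `x`. -/
lemma moveLoops_of_ne {ends : E → Sym2 V} {x y : V} {e : E} (h : ends e ≠ s(x, x)) :
    moveLoops ends x y e = ends e := by
  simp [moveLoops, h]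

omit [DecidableEq E] in
/-- `moveLoops` preserves loops. -/
lemma moveLoops_isDiag_iff (ends : E → Sym2 V) (x y : V) (e : E) :
    (moveLoops ends x y e).IsDiag ↔ (ends e).IsDiag := by
  unfold moveLoops
  split_ifs with h
  · rw [h]; simp
  · rfl

omit [DecidableEq E] in
/-- Connections only depend on the non-loop edges: two edge maps that agree on non-loop edges and
have the same loops give the same connections. -/
lemma conn_of_conn_of_eqOn_nonloop {ends ends' : E → Sym2 V}
    (hdiag : ∀ e, (ends e).IsDiag → (ends' e).IsDiag)
    (heq : ∀ e, ¬ (ends e).IsDiag → ends' e = ends e) {ω : Config E} {m₁ m₂ : V}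
    (h : Conn ends' ω m₁ m₂) : Conn ends ω m₁ m₂ := by
  let S : Set V := {z | Conn ends ω m₁ z}
  have hS : ∀ z ∈ S, ∀ z', (openGraph ends' ω).Adj z z' → z' ∈ S := by
    intro z hz z' hzz'
    obtain ⟨hne, e, he, hends⟩ := openGraph_adj.1 hzz'
    by_cases hd : (ends e).IsDiag
    · have := hdiag e hd
      rw [hends, Sym2.mk_isDiag_iff] at this
      exact absurd this hne
    · rw [heq e hd] at hends
      exact conn_trans hz (conn_of_openAdj ⟨e, he, hends⟩)
  exact mem_of_conn_of_closed hS (conn_refl ends ω m₁) h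

omit [DecidableEq E] in
/-- Moving loops does not change connections. -/
lemma conn_moveLoops_iff (ends : E → Sym2 V) (x y : V) (ω : Config E) (m₁ m₂ : V) :
    Conn (moveLoops ends x y) ω m₁ m₂ ↔ Conn ends ω m₁ m₂ := by
  constructor
  · exact conn_of_conn_of_eqOn_nonloop (fun e hd => (moveLoops_isDiag_iff ends x y e).2 hd)
      (fun e hd => moveLoops_of_ne (fun h => hd (by rw [h]; simp)))
  · exact conn_of_conn_of_eqOn_nonloop (fun e hd => (moveLoops_isDiag_iff ends x y e).1 hd)
      (fun e hd => (moveLoops_of_ne (fun h => hd ((moveLoops_isDiag_iff ends x y e).2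
        (by rw [h]; simp)))).symm)

omit [DecidableEq E] in
/-- Moving loops does not change connection events. -/
lemma connEvent_moveLoops (ends : E → Sym2 V) (x y : V) (m₁ m₂ : V) :
    connEvent (moveLoops ends x y) m₁ m₂ = connEvent ends m₁ m₂ := by
  ext ω
  exact conn_moveLoops_iff ends x y ω m₁ m₂

end Loops

section LoopsForm

variable {V : Type*} {E : Type*} [Fintype E] [DecidableEq E] [Fintype V] [DecidableEq V]
  {R : Type*} [CommRing R] [LinearOrder R] [IsStrictOrderedRing R]

omit [Fintype V] [LinearOrder R] [IsStrictOrderedRing R] in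
/-- Moving loops does not change the (MM0⁻) form. -/
lemma mm0minusForm_moveLoops (p : E → R) (ends : E → Sym2 V) (x y s t b u w v : V) :
    mm0minusForm p (moveLoops ends x y) s t b u w v = mm0minusForm p ends s t b u w v := by
  simp only [mm0minusForm, gate, bridge, Zev, connEvent_moveLoops]

end LoopsForm

/-! ## The reduction: (MM0⁻) on every graph follows from (MM0⁻) on the reduced graphs -/

section Reduce

variable {V : Type*} {E : Type*} [Fintype E] [DecidableEq E] [Fintype V] [DecidableEq V]
  {R : Type*} [CommRing R] [LinearOrder R] [IsStrictOrderedRing R]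

/-- The non-loop edges at a vertex. -/
def nonloopAt (ends : E → Sym2 V) (x : V) : Finset E :=
  Finset.univ.filter fun e => x ∈ ends e ∧ ¬ (ends e).IsDiag

/-- All non-loop edges. -/
def nonloop (ends : E → Sym2 V) : Finset E := Finset.univ.filter fun e => ¬ (ends e).IsDiag

/-- A marking is REDUCED when every unmarked vertex has no non-loop edge or at least three, and no
two distinct non-loop edges are parallel (same end pair). -/
def Reduced (ends : E → Sym2 V) (M : Finset V) : Prop :=
  (∀ x, x ∉ M → (nonloopAt ends x).card = 0 ∨ 3 ≤ (nonloopAt ends x).card) ∧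
    ∀ e₁ e₂, e₁ ≠ e₂ → ¬ (ends e₁).IsDiag → ends e₁ ≠ ends e₂

omit [Fintype V] [DecidableEq E] in
/-- Membership in `nonloopAt`. -/
lemma mem_nonloopAt {ends : E → Sym2 V} {x : V} {e : E} :
    e ∈ nonloopAt ends x ↔ x ∈ ends e ∧ ¬ (ends e).IsDiag := by
  simp [nonloopAt]

omit [Fintype V] [DecidableEq E] in
/-- Membership in `nonloop`. -/
lemma mem_nonloop {ends : E → Sym2 V} {e : E} : e ∈ nonloop ends ↔ ¬ (ends e).IsDiag := by
  simp [nonloop]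

omit [Fintype V] in
/-- Re-pointing an edge to a loop removes it from the non-loop edges. -/
lemma nonloop_update_loop_subset (ends : E → Sym2 V) (f : E) (x : V) :
    nonloop (Function.update ends f s(x, x)) ⊆ (nonloop ends).erase f := by
  intro e he
  rw [mem_nonloop] at he
  by_cases hef : e = f
  · rw [hef, Function.update_self] at he
    exact absurd (by simp) he
  · rw [Function.update_of_ne hef] at he
    exact Finset.mem_erase.2 ⟨hef, mem_nonloop.2 he⟩

omit [Fintype V] in
/-- The series reduction removes `e₂` from the non-loop edges. -/
lemma nonloop_seriesEnds_subset (ends : E → Sym2 V) {e₁ e₂ : E} {a c x : V}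
    (h1 : ends e₁ = s(a, x)) (hax : a ≠ x) :
    nonloop (MM0Series.seriesEnds ends e₁ e₂ a c x) ⊆ (nonloop ends).erase e₂ := by
  intro e he
  rw [mem_nonloop] at he
  by_cases hee2 : e = e₂
  · rw [hee2, MM0Series.seriesEnds_apply_e₂] at he
    exact absurd (by simp) he
  by_cases hee1 : e = e₁
  · refine Finset.mem_erase.2 ⟨hee2, mem_nonloop.2 ?_⟩
    rw [hee1, h1, Sym2.mk_isDiag_iff]
    exact hax
  · rw [MM0Series.seriesEnds_apply_of_ne hee1 hee2] at he
    exact Finset.mem_erase.2 ⟨hee2, mem_nonloop.2 he⟩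

omit [Fintype V] in
/-- The parallel reduction removes `e₂` from the non-loop edges. -/
lemma nonloop_parallelEnds_subset (ends : E → Sym2 V) (e₂ : E) (y : V) :
    nonloop (MM0Parallel.parallelEnds ends e₂ y) ⊆ (nonloop ends).erase e₂ := by
  intro e he
  rw [mem_nonloop] at he
  by_cases hee2 : e = e₂
  · rw [hee2] at he
    exact absurd (by simp [MM0Parallel.parallelEnds]) he
  · rw [show MM0Parallel.parallelEnds ends e₂ y e = ends e from Function.update_of_ne hee2 _ _] at he
    exact Finset.mem_erase.2 ⟨hee2, mem_nonloop.2 he⟩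

omit [Fintype V] [DecidableEq E] in
/-- Moving loops does not change the non-loop edge set. -/
lemma nonloop_moveLoops (ends : E → Sym2 V) (x y : V) : nonloop (moveLoops ends x y) = nonloop ends := by
  ext e
  simp only [mem_nonloop, moveLoops_isDiag_iff]

omit [Fintype V] [DecidableEq E] in
/-- Moving loops does not change the non-loop edges at any vertex. -/
lemma nonloopAt_moveLoops (ends : E → Sym2 V) (x y z : V) :
    nonloopAt (moveLoops ends x y) z = nonloopAt ends z := by
  ext e
  simp only [mem_nonloopAt, moveLoops_isDiag_iff]
  constructor
  · rintro ⟨hz, hd⟩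
    refine ⟨?_, hd⟩
    rwa [moveLoops_of_ne (fun h => hd (by rw [h]; simp))] at hz
  · rintro ⟨hz, hd⟩
    refine ⟨?_, hd⟩
    rwa [moveLoops_of_ne (fun h => hd (by rw [h]; simp))]

omit [Fintype E] [DecidableEq E] [Fintype V] in
/-- After moving the loops at `x` to `y ≠ x`, no loop touches `x`. -/
lemma notMem_of_isDiag_moveLoops {ends : E → Sym2 V} {x y : V} (hxy : x ≠ y) {e : E}
    (hd : (moveLoops ends x y e).IsDiag) : x ∉ moveLoops ends x y e := by
  unfold moveLoops at hd ⊢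
  split_ifs at hd ⊢ with h
  · simp [hxy]
  · intro hx
    obtain ⟨z, hz⟩ := Sym2.mem_iff_exists.1 hx
    rw [hz, Sym2.mk_isDiag_iff] at hd
    exact h (by rw [hz, hd])

omit [Fintype V] in
/-- **The reduction theorem**: if `(MM0⁻)` holds for every weight vector on every REDUCED marking
(every unmarked vertex has no non-loop edge or at least three, no parallel non-loop edges), then it
holds on every graph. Proof: strong induction on the number of non-loop edges; two parallel non-loop
edges are merged (`MM0Parallel.mm0minusForm_parallel`), an unmarked vertex with one non-loop edge is
pruned (`MM0Prune.mm0minusForm_update_loop`), one with two is suppressed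
(`MM0Series.mm0minusForm_series`, weights multiply), after its loops are moved out of the way. -/
theorem mm0minus_of_reduced (p : E → R) (hp : IsProbVec p) (ends : E → Sym2 V) (s t b u w v : V)
    (hred : ∀ (ends' : E → Sym2 V) (p' : E → R), IsProbVec p' →
      Reduced ends' {s, t, b, u, w, v} → mm0minusForm p' ends' s t b u w v ≤ 0) :
    mm0minusForm p ends s t b u w v ≤ 0 := by
  suffices H : ∀ n, ∀ (ends : E → Sym2 V) (p : E → R), IsProbVec p → (nonloop ends).card = n →
      mm0minusForm p ends s t b u w v ≤ 0 from H _ ends p hp rfl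
  intro n
  induction n using Nat.strong_induction_on with
  | _ n ih =>
  intro ends p hp hn
  by_cases hr : Reduced ends {s, t, b, u, w, v}
  · exact hred ends p hp hr
  by_cases hpar : ∃ e₁ e₂, e₁ ≠ e₂ ∧ ¬ (ends e₁).IsDiag ∧ ends e₁ = ends e₂
  · -- two parallel non-loop edges: merge them
    obtain ⟨e₁, e₂, h12, hd1, hpar⟩ := hpar
    rw [MM0Parallel.mm0minusForm_parallel (y := s) hpar h12 p s t b u w v]
    have hp' : IsProbVec (Function.update p e₁ (1 - (1 - p e₁) * (1 - p e₂))) := by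
      refine ⟨fun e => ?_, fun e => ?_⟩
      · by_cases he : e = e₁
        · rw [he, Function.update_self]
          have h1 : (1 - p e₁) * (1 - p e₂) ≤ 1 :=
            mul_le_one₀ (by linarith [hp.nonneg e₁]) (by linarith [hp.le_one e₂])
              (by linarith [hp.nonneg e₂])
          linarith
        · rw [Function.update_of_ne he]; exact hp.nonneg e
      · by_cases he : e = e₁
        · rw [he, Function.update_self]
          have h1 : 0 ≤ (1 - p e₁) * (1 - p e₂) :=
            mul_nonneg (by linarith [hp.le_one e₁]) (by linarith [hp.le_one e₂])
          linarith
        · rw [Function.update_of_ne he]; exact hp.le_one e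
    have hd2 : ¬ (ends e₂).IsDiag := by rw [← hpar]; exact hd1
    refine ih _ ?_ _ _ hp' rfl
    calc (nonloop (MM0Parallel.parallelEnds ends e₂ s)).card
        ≤ ((nonloop ends).erase e₂).card :=
          Finset.card_le_card (nonloop_parallelEnds_subset ends e₂ s)
      _ = (nonloop ends).card - 1 := Finset.card_erase_of_mem (mem_nonloop.2 hd2)
      _ < n := by
          have hpos : 0 < (nonloop ends).card := Finset.card_pos.2 ⟨e₂, mem_nonloop.2 hd2⟩
          rw [hn] at hpos ⊢; omega
  -- no parallel edges: an unmarked vertex of non-loop degree one or two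
  have hr' : ¬ ∀ x, x ∉ ({s, t, b, u, w, v} : Finset V) →
      (nonloopAt ends x).card = 0 ∨ 3 ≤ (nonloopAt ends x).card := by
    intro hdeg
    exact hr ⟨hdeg, fun e₁ e₂ h12 hd1 heq => hpar ⟨e₁, e₂, h12, hd1, heq⟩⟩
  simp only [not_forall, not_or, not_le] at hr'
  obtain ⟨x, hxM, hx0, hx3⟩ := hr'
  have hxs : x ≠ s := fun h => hxM (by simp [h])
  have hxt : x ≠ t := fun h => hxM (by simp [h])
  have hxb : x ≠ b := fun h => hxM (by simp [h])
  have hxu : x ≠ u := fun h => hxM (by simp [h])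
  have hxw : x ≠ w := fun h => hxM (by simp [h])
  have hxv : x ≠ v := fun h => hxM (by simp [h])
  -- move the loops at `x` to `s`
  set ends₁ := moveLoops ends x s with hends₁
  have hform₁ : mm0minusForm p ends s t b u w v = mm0minusForm p ends₁ s t b u w v :=
    (mm0minusForm_moveLoops p ends x s s t b u w v).symm
  have hcard₁ : (nonloop ends₁).card = n := by rw [hends₁, nonloop_moveLoops]; exact hn
  have hat₁ : nonloopAt ends₁ x = nonloopAt ends x := nonloopAt_moveLoops ends x s x
  have hnoloop : ∀ e, x ∈ ends₁ e → ¬ (ends₁ e).IsDiag := fun e hx hd =>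
    notMem_of_isDiag_moveLoops hxs hd hx
  rw [hform₁]
  -- the bad vertex has one or two non-loop edges
  have hcases : (nonloopAt ends₁ x).card = 1 ∨ (nonloopAt ends₁ x).card = 2 := by
    rw [hat₁]
    rcases Nat.lt_trichotomy (nonloopAt ends x).card 1 with h | h | h
    · exact absurd (Nat.lt_one_iff.1 h) hx0
    · exact Or.inl h
    · exact Or.inr (by omega)
  rcases hcases with h1 | h2
  · -- one non-loop edge: prune
    obtain ⟨f, hf⟩ := Finset.card_eq_one.1 h1
    have hfmem : f ∈ nonloopAt ends₁ x := by rw [hf]; exact Finset.mem_singleton_self f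
    obtain ⟨hxf, hfd⟩ := mem_nonloopAt.1 hfmem
    obtain ⟨y, hy⟩ := Sym2.mem_iff_exists.1 hxf
    have hxy : x ≠ y := by
      intro h; apply hfd; rw [hy, h]; simp
    have hleaf : ∀ e, x ∈ ends₁ e → e = f := by
      intro e he
      have : e ∈ nonloopAt ends₁ x := mem_nonloopAt.2 ⟨he, hnoloop e he⟩
      rw [hf] at this
      exact Finset.mem_singleton.1 this
    rw [← MM0Prune.mm0minusForm_update_loop p hy hleaf hxy hxs.symm hxt.symm hxb.symm hxu.symm
      hxw.symm hxv.symm]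
    refine ih _ ?_ _ p hp rfl
    calc (nonloop (Function.update ends₁ f s(x, x))).card
        ≤ ((nonloop ends₁).erase f).card := Finset.card_le_card (nonloop_update_loop_subset ends₁ f x)
      _ = (nonloop ends₁).card - 1 := Finset.card_erase_of_mem (mem_nonloop.2 hfd)
      _ < n := by
          have hpos : 0 < (nonloop ends₁).card := Finset.card_pos.2 ⟨f, mem_nonloop.2 hfd⟩
          rw [hcard₁] at hpos ⊢; omega
  · -- two non-loop edges: series
    obtain ⟨e₁, e₂, h12, hf⟩ := Finset.card_eq_two.1 h2
    have h1mem : e₁ ∈ nonloopAt ends₁ x := by rw [hf]; simp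
    have h2mem : e₂ ∈ nonloopAt ends₁ x := by rw [hf]; simp
    obtain ⟨hx1, hd1⟩ := mem_nonloopAt.1 h1mem
    obtain ⟨hx2, hd2⟩ := mem_nonloopAt.1 h2mem
    obtain ⟨a, ha⟩ := Sym2.mem_iff_exists.1 hx1
    obtain ⟨c, hc⟩ := Sym2.mem_iff_exists.1 hx2
    have hax : a ≠ x := by
      intro h; apply hd1; rw [ha, h]; simp
    have hcx : c ≠ x := by
      intro h; apply hd2; rw [hc, h]; simp
    have ha' : ends₁ e₁ = s(a, x) := by rw [ha, Sym2.eq_swap]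
    have hdeg : ∀ e, x ∈ ends₁ e → e = e₁ ∨ e = e₂ := by
      intro e he
      have : e ∈ nonloopAt ends₁ x := mem_nonloopAt.2 ⟨he, hnoloop e he⟩
      rw [hf] at this
      simpa using this
    rw [MM0Series.mm0minusForm_series ha' hc hdeg hax hcx h12 p hxs.symm hxt.symm hxb.symm hxu.symm
      hxw.symm hxv.symm]
    have hp' : IsProbVec (Function.update p e₁ (p e₁ * p e₂)) := by
      refine ⟨fun e => ?_, fun e => ?_⟩
      · by_cases he : e = e₁
        · rw [he, Function.update_self]; exact mul_nonneg (hp.nonneg e₁) (hp.nonneg e₂)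
        · rw [Function.update_of_ne he]; exact hp.nonneg e
      · by_cases he : e = e₁
        · rw [he, Function.update_self]
          exact mul_le_one₀ (hp.le_one e₁) (hp.nonneg e₂) (hp.le_one e₂)
        · rw [Function.update_of_ne he]; exact hp.le_one e
    refine ih _ ?_ _ _ hp' rfl
    calc (nonloop (MM0Series.seriesEnds ends₁ e₁ e₂ a c x)).card
        ≤ ((nonloop ends₁).erase e₂).card :=
          Finset.card_le_card (nonloop_seriesEnds_subset ends₁ ha' hax)
      _ = (nonloop ends₁).card - 1 := Finset.card_erase_of_mem (mem_nonloop.2 hd2)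
      _ < n := by
          have hpos : 0 < (nonloop ends₁).card := Finset.card_pos.2 ⟨e₂, mem_nonloop.2 hd2⟩
          rw [hcard₁] at hpos ⊢; omega

end Reduce

end MM0Reduce
end Summit.Ventures.PercRepro2
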